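import Summits.ResolutionOfSingularities.ResolutionOfSingularities.Theorems.PurelyInseparableDim4UniformTrapFrames
import Summits.ResolutionOfSingularities.ResolutionOfSingularities.Theorems.PurelyInseparableDim4IsolatedBand
import Summits.ResolutionOfSingularities.ResolutionOfSingularities.Theorems.PurelyInseparableDim4IsolatedCleaning
import Summits.ResolutionOfSingularities.ResolutionOfSingularities.Theorems.PurelyInseparableDim4IsolatedPoint
import Summits.ResolutionOfSingularities.ResolutionOfSingularities.Theorems.PurelyInseparableDim4ScopeWitness
import Mathlib.RingTheory.PowerSeries.Inverse
import HarnessLib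

/-!
# The uniform trap `T-002(q)` is OUT OF COORDINATE SCOPE and NOT ISOLATED at every `q ≥ 2`
# (cell `res-dim4-pi`; frame v4 regimes vs. the all-`p` blindness of `…UniformTrapFrames`)

[OURS · counted 0] Nothing here is a statement about resolution of singularities.

`…UniformTrapFrames` kills the frames v1–v3 at every prime `p` and every `q ≥ 2` with the specimen
`F_ε = x₃^{q−1}(x₄ + εx₂ + x₂x₄)` (`ε = ±1`).  Here that dead branch is placed OUTSIDE both TIER-1 regimes of
frame v4, BY PROOF and for every `q` (the census' EN-9 verdict «BLIND-REGULAR» was `p = q = 2`, Sage;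
res-dim4-p-3's `…ScopeWitness` has the `q = 2` kernel certificate `not_inCoordinateScope_two_trapF3`):

* `hasseDeriv_top`: `D^{((q−1)·e₃)} F_ε = w := x₄ + εx₂ + x₂x₄`; every other Hasse derivative of order
  `< q` lies in `(x₃)` (`hasseDeriv_mem_span_X2`) — so `V(J_q⁺(F_ε)) = V(x₃, w)`, a regular NON-coordinate
  surface;
* the power-series curve `γ(T) = (0, T, 0, −εT/(1+T))` kills every `D^{(α)}F_ε`, `0 < |α| < q`
  (`aeval_curve_hasseDeriv`), while `w(0,0,0,1) = 1`; res-dim4-p-3's kernel-form certificate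
  `IsolationCert.not_inCoordinateScope_of_ringHom` then gives **`¬ InCoordinateScope q (F q ε)`**
  (`not_inCoordinateScope_F`, `ε ≠ 0`, `q ≥ 2`, any field);
* the LINE `V(z,x₂,x₃,x₄) ≠` point is Hironaka-permissible, so **`¬ IsIsolated q (F q ε)`**
  (`not_isIsolated_F`, via `IsolationCert.not_isIsolated_of_le_ordAlong_of_ne_univ`);
* hence every state of the dead branch `chain q` is out of scope and non-isolated
  (`chain_not_inCoordinateScope`, `chain_not_isIsolated`): it is no evidence against F4-C / F4-I.
OURS; counted 0.  bears_on: LADDER-RESOLUTION:D157-DOOR2 (res-dim4-pi · W3-2 · frame v4).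
Supports stmt-ResolutionOfSingularities-16155 (helper).
-/

set_option linter.dupNamespace false -- mandated namespace of this single-conjunct summit

noncomputable section

open MvPolynomial Finset

namespace Summit.ResolutionOfSingularities.ResolutionOfSingularities.Theorems.PIDim4

namespace UniformTrapScope

open Literature.AlgebraicGeometry.Resolution
open Literature.AlgebraicGeometry.Resolution.CentreBlowup

variable {K : Type} [Field K]

/-! ## §1 The curve, the top Hasse derivative -/



open UniformTrap

/-- The inverse of `1 + T` in `K⟦T⟧`. [folklore] -/
def invOnePlus : PowerSeries K := PowerSeries.invOfUnit (1 + PowerSeries.X) 1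

/-- `(1 + T) · (1 + T)⁻¹ = 1`. -/
theorem one_add_X_mul_invOnePlus : (1 + PowerSeries.X) * (invOnePlus : PowerSeries K) = 1 :=
  PowerSeries.mul_invOfUnit _ _ (by simp)

/-- The witness curve `γ(T) = (0, T, 0, −εT/(1+T))`. [folklore] -/
def curve (ε : K) : Fin 4 → PowerSeries K :=
  ![0, PowerSeries.X, 0, -(PowerSeries.C ε * PowerSeries.X * invOnePlus)]

/-- `γ₀ = 0`. -/ @[simp] theorem curve_zero (ε : K) : curve ε 0 = 0 := rfl
/-- `γ₁ = T`. -/ @[simp] theorem curve_one (ε : K) : curve ε 1 = PowerSeries.X := rfl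
/-- `γ₂ = 0`. -/ @[simp] theorem curve_two (ε : K) : curve ε 2 = 0 := rfl
/-- `γ₃ = −εT/(1+T)`. -/
@[simp] theorem curve_three (ε : K) : curve ε 3 = -(PowerSeries.C ε * PowerSeries.X * invOnePlus) := rfl

/-- The curve passes through the origin. -/
theorem curve_constantCoeff (ε : K) (i : Fin 4) : PowerSeries.constantCoeff (curve ε i) = 0 := by
  fin_cases i <;> simp

/-- `w = x₄ + εx₂ + x₂x₄` vanishes on the curve. [folklore] -/
theorem aeval_curve_w (ε : K) :
    MvPolynomial.aeval (curve ε) (X 3 + C ε * X 1 + X 1 * X 3 : MvPolynomial (Fin 4) K) = 0 := by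
  simp only [map_add, map_mul, MvPolynomial.aeval_X, MvPolynomial.aeval_C, curve_three, curve_one]
  rw [← PowerSeries.C_eq_algebraMap]
  have h := one_add_X_mul_invOnePlus (K := K)
  linear_combination (-(PowerSeries.C ε * PowerSeries.X)) * h

/-- `x₃` vanishes on the curve. -/
theorem aeval_curve_X2 (ε : K) : MvPolynomial.aeval (curve ε) (X 2 : MvPolynomial (Fin 4) K) = 0 := by
  simp

/-- Hasse derivative of a monomial (from the coefficient formula). [folklore] -/
theorem hasseDeriv_monomial' (α d : Fin 4 →₀ ℕ) (c : K) (hαd : α ≤ d) :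
    hasseDeriv α (monomial d c) = monomial (d - α) ((∏ i, (Nat.choose (d i) (α i) : K)) * c) := by
  classical
  ext e
  rw [IsolatedBand.coeff_hasseDeriv, coeff_monomial, coeff_monomial]
  by_cases h : d = e + α
  · have h' : d - α = e := by rw [h, add_tsub_cancel_right]
    rw [if_pos h, if_pos h']
    simp [h, Finsupp.add_apply]
  · have h' : ¬ d - α = e := fun h' => h (by rw [← h', tsub_add_cancel_of_le hαd])
    rw [if_neg h, if_neg h', mul_zero]

/-- The top Hasse derivative index `α* = (q−1)·e_{x₃}`. [folklore] -/
def top (q : ℕ) : Fin 4 →₀ ℕ := Finsupp.single 2 (q - 1)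

/-- **`D^{(α*)} F_ε = w = x₄ + εx₂ + x₂x₄`.** [folklore] -/
theorem hasseDeriv_top (q : ℕ) (ε : K) :
    hasseDeriv (top q) (F q ε) = X 3 + C ε * X 1 + X 1 * X 3 := by
  have h1 : top q ≤ e1 q := by intro i; fin_cases i <;> simp [top]
  have h2 : top q ≤ e2 q := by intro i; fin_cases i <;> simp [top]
  have h3 : top q ≤ e3 q := by intro i; fin_cases i <;> simp [top]
  have d1 : e1 q - top q = Finsupp.single 3 1 := by ext i; fin_cases i <;> simp [top]
  have d2 : e2 q - top q = Finsupp.single 1 1 := by ext i; fin_cases i <;> simp [top]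
  have d3 : e3 q - top q = Finsupp.single 1 1 + Finsupp.single 3 1 := by ext i; fin_cases i <;> simp [top]
  have p1 : (∏ i, (Nat.choose (e1 q i) (top q i) : K)) = 1 := by simp [Fin.prod_univ_four, top]
  have p2 : (∏ i, (Nat.choose (e2 q i) (top q i) : K)) = 1 := by simp [Fin.prod_univ_four, top]
  have p3 : (∏ i, (Nat.choose (e3 q i) (top q i) : K)) = 1 := by simp [Fin.prod_univ_four, top]
  rw [F, IsolatedBand.hasseDeriv_add, IsolatedBand.hasseDeriv_add, hasseDeriv_monomial' _ _ _ h1,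
    hasseDeriv_monomial' _ _ _ h2, hasseDeriv_monomial' _ _ _ h3, d1, d2, d3, p1, p2, p3]
  simp only [one_mul, MvPolynomial.X, C_mul_monomial, monomial_mul, mul_one]

/-- Every monomial of `F_ε` has `x₃`-exponent `q − 1`. -/
theorem support_F_layer (q : ℕ) (ε : K) : ∀ e ∈ (F q ε).support, q - 1 ≤ e 2 := by
  intro e he
  have := support_F_subset q ε he
  simp only [Finset.mem_insert, Finset.mem_singleton] at this
  rcases this with rfl | rfl | rfl <;> simp

/-- A Hasse derivative of `F_ε` of order `< q` other than along `α*` lies in `(x₃)`. [folklore] -/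
theorem hasseDeriv_mem_span_X2 {q : ℕ} (ε : K) {α : Fin 4 →₀ ℕ} (hα : α 2 < q - 1) :
    hasseDeriv α (F q ε) ∈ Ideal.span {(X 2 : MvPolynomial (Fin 4) K)} :=
  IsolatedBand.hasseDeriv_mem_span_X_of_layer (support_F_layer q ε) hα

/-- An order-`< q` index with `α₃ ≥ q − 1` and `|α| > 0` is `α*` (for `q ≥ 2`). -/
theorem eq_top_of {q : ℕ} (hq : 2 ≤ q) {α : Fin 4 →₀ ℕ} (hαq : α.degree < q) (hα : ¬ α 2 < q - 1) :
    α = top q := by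
  have hsum : α.degree = α 0 + α 1 + α 2 + α 3 := by
    rw [← degIn_univ]; simp [degIn, Fin.sum_univ_four]
  ext i
  fin_cases i <;> simp [top] <;> omega

/-- **Every Hasse derivative `D^{(α)}F_ε`, `0 < |α| < q`, vanishes on the curve.** [folklore] -/
theorem aeval_curve_hasseDeriv {q : ℕ} (hq : 2 ≤ q) (ε : K) (α : Fin 4 →₀ ℕ) (_h0 : 0 < α.degree)
    (hαq : α.degree < q) : MvPolynomial.aeval (curve ε) (hasseDeriv α (F q ε)) = 0 := by
  by_cases hα : α 2 < q - 1
  · obtain ⟨c, hc⟩ := Ideal.mem_span_singleton'.mp (hasseDeriv_mem_span_X2 ε hα)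
    rw [← hc, map_mul, aeval_curve_X2, mul_zero]
  · rw [eq_top_of hq hαq hα, hasseDeriv_top, aeval_curve_w]

/-- The curve factors the evaluation at the origin: `γ(0) = 0`. -/
theorem eval_zero_of_aeval_curve (ε : K) (g : MvPolynomial (Fin 4) K)
    (hg : (MvPolynomial.aeval (curve ε)).toRingHom g = 0) : MvPolynomial.eval (0 : Fin 4 → K) g = 0 := by
  have hcomp : (PowerSeries.constantCoeff (R := K)).comp (MvPolynomial.aeval (curve ε)).toRingHom =
      MvPolynomial.eval (0 : Fin 4 → K) := by
    refine MvPolynomial.ringHom_ext (fun c => ?_) (fun i => ?_)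
    · simp
    · simp [curve_constantCoeff ε i]
  rw [← hcomp, RingHom.comp_apply, hg, map_zero]

/-- `w(0,0,0,1) = 1`. -/
theorem eval_w_point (ε : K) :
    MvPolynomial.eval (![0, 0, 0, 1] : Fin 4 → K) (X 3 + C ε * X 1 + X 1 * X 3 : MvPolynomial (Fin 4) K) = 1 := by
  simp

/-- On the curve `x₄` does not vanish identically (`ε ≠ 0`). -/
theorem curve_three_ne_zero {ε : K} (hε : ε ≠ 0) : curve ε 3 ≠ 0 := by
  have hinv : (invOnePlus : PowerSeries K) ≠ 0 := fun h => by
    have h1 := one_add_X_mul_invOnePlus (K := K); rw [h, mul_zero] at h1; exact zero_ne_one h1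
  have hC : (PowerSeries.C ε : PowerSeries K) ≠ 0 := by
    intro h; apply hε; have := congrArg PowerSeries.constantCoeff h; simpa using this
  intro h
  rw [curve_three, neg_eq_zero] at h
  rcases mul_eq_zero.mp h with h | h
  · rcases mul_eq_zero.mp h with h | h
    · exact hC h
    · exact PowerSeries.X_ne_zero h
  · exact hinv h

/-- **The uniform trap is OUT OF COORDINATE SCOPE** at every `q ≥ 2` (`ε ≠ 0`, any field), by
res-dim4-p-3's kernel-form certificate with `φ = aeval γ`, `V = {x₁, x₃}`, `α = (q−1)·e₃`, `a = (0,0,0,1)`.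
[folklore] -/
theorem not_inCoordinateScope_F {q : ℕ} (hq : 2 ≤ q) {ε : K} (hε : ε ≠ 0) : ¬ InCoordinateScope q (F q ε) := by
  refine IsolationCert.not_inCoordinateScope_of_ringHom (MvPolynomial.aeval (curve ε)).toRingHom
    (fun α h0 hαq => aeval_curve_hasseDeriv hq ε α h0 hαq) (eval_zero_of_aeval_curve ε) {0, 2}
    (fun i hi => ?_) (top q) ?_ ?_ ![0, 0, 0, 1] (fun i hi => ?_) ?_
  · change MvPolynomial.aeval (curve ε) (X i) ≠ 0
    rw [MvPolynomial.aeval_X]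
    fin_cases i
    · exact absurd (by simp) hi
    · exact PowerSeries.X_ne_zero
    · exact absurd (by simp) hi
    · exact curve_three_ne_zero hε
  · rw [top, Finsupp.degree_single]; omega
  · rw [top, Finsupp.degree_single]; omega
  · simp only [Finset.mem_insert, Finset.mem_singleton] at hi
    rcases hi with rfl | rfl <;> rfl
  · rw [hasseDeriv_top, eval_w_point]; exact one_ne_zero

/-- **The uniform trap is NOT ISOLATED** (the line `V(z,x₂,x₃,x₄)` is permissible). [folklore] -/
theorem not_isIsolated_F {q : ℕ} (hq : 1 ≤ q) (ε : K) : ¬ IsIsolated q (F q ε) :=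
  IsolationCert.not_isIsolated_of_le_ordAlong_of_ne_univ (S := T123)
    (by rw [ordAlong_F subset_rfl hq ε]) (by decide)

/-- Every state of the dead branch `s₁, s₋₁, s₁, …` of `…UniformTrapFrames` is out of coordinate scope. -/
theorem chain_not_inCoordinateScope {q : ℕ} (hq : 2 ≤ q) (k : ℕ) :
    ¬ InCoordinateScope q (chain (K := K) q k).F := by
  obtain ⟨ε, hε, h⟩ := chain_cases (K := K) q k
  rw [h]; exact not_inCoordinateScope_F hq hε

/-- … and not isolated. -/
theorem chain_not_isIsolated {q : ℕ} (hq : 2 ≤ q) (k : ℕ) : ¬ IsIsolated q (chain (K := K) q k).F := by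
  obtain ⟨ε, _, h⟩ := chain_cases (K := K) q k
  rw [h]; exact not_isIsolated_F (by omega) ε

end UniformTrapScope

end Summit.ResolutionOfSingularities.ResolutionOfSingularities.Theorems.PIDim4

end
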